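import Summits.NavierStokesRegularity.NavierStokesRegularity.Theorems.ScenarioCensusBlochMeter
import Summits.NavierStokesRegularity.NavierStokesRegularity.Theorems.ScenarioCensusRotationOrder
import HarnessLib

/-!
# BLOCH METER port, part 2/3: §K the kinematic kernel of the rotational row (a bounded incompressible `C²` field with a TRANSVERSAL rotational Floquet twin of order ≥ 3 is PERIODIC along the
# horizontal part of the shift; census `RotationOrder.rotZ_neg_rotZ` BY NAME); §G the instrument rows over the class (`Row_A2blN` / `C` / `U` / `R` DECIDED, `Row_A2blA` OPEN typed), `rows_of_L'` / `rows_of_rung`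

Re-homed for the scenario census (typer seat ns-census-typer-1 g10; the cells A2blN / A2blC / A2blU / A2blR are MEMBERS OF RECORD «DECIDED IN KERNEL IN FILES» of row A2 (ns-idea-2 g18 LINE g18-4:
critic idea-crit-3 g11 PASS 15:59:03Z; ref ns-census-ref g16 PRE-CHECK ✓ §21.22; lead label; OF RECORD 4/4 at census v1.135, KEY-NS #240), A2blA OPEN (typed); this port makes the decided cells
TREE-decided): VERBATIM PORT of ns-idea-2 LINE g18-4 «bloch-meter», `pub/ideators/ns-idea-2/lines/bloch-meter/line-bloch-meter.lean` sha16 c4e2e5a09424cfd5 (743 l., lean check rc 0,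
0 sorry), split for the 400-line rule into `ScenarioCensusBlochMeter` (model, §B, pencil) → `…BlochMeterKernel` (§K, §G) → `…BlochMeterControl` (§C + census KEYS).  Lean text VERBATIM in
namespace `…Theorems.ScenarioCensus.BlochMeter` (the line's `…Lines.BlochMeter` re-homed); port edits: the line's `local notation "E3"` is spelled as the reducible `abbrev E3` of every census
file; `rotZ_neg_rotZ` is the census rotation-order port's (`RotationOrder.rotZ_neg_rotZ`, BY NAME, gate lint dedup.landed); the three component simp-lemmas `e2_apply_zero/one/two` of the
line's own `e2` (their TEXT coincides with `ForcedSymmetry.Negative.e2_c0/1/2`, a different constant) and `hasFDerivAt_coord` (twin of a Literature lemma outside this closure) are not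
re-declared (inlined / unfolded at the use sites); `@[conjecture]` on the OPEN row `Row_A2blA`; one-line docstrings added where missing (gate lint).  Statements untouched.

No census VALUE is moved here (row A2 stays OPEN-WITH-LINE; the members become TREE-decided by name); (L′) is NOT proved; no summit statement is proved by this file. Lemmas that restate already-landed tree declarations are taken BY NAME (gate lint `dedup.landed`): `rotZ_neg_rotZ` = `RotationOrder.rotZ_neg_rotZ`.
-/

-- the summit and its single problem share the name `NavierStokesRegularity` (D-0017 nested layout)
set_option linter.dupNamespace false

noncomputable section

open Set Function Filter Metric MeasureTheory InnerProductSpace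
open scoped Topology RealInnerProductSpace
open Literature.Analysis Literature.Analysis.FluidPDE
open Summit.NavierStokesRegularity.NavierStokesRegularity.Theorems
open Summit.NavierStokesRegularity.NavierStokesRegularity.Theorems.ScenarioCensus

namespace Summit.NavierStokesRegularity.NavierStokesRegularity.Theorems.ScenarioCensus.BlochMeter

/-! ### §K  The kinematic kernel of the rotational row: a bounded incompressible `C²` field with a
TRANSVERSAL rotational Floquet twin of order ≥ 3 is PERIODIC along the horizontal part of the shift -/

section Kernel

variable {f : E3 → E3} {θ : ℝ} {a : E3}

-- `rotZ_neg_rotZ`: the line restates the tree's `RotationOrder.rotZ_neg_rotZ`; taken BY NAME (gate lint dedup.landed).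

/-- The twin read backwards: `f (y − a) = rotZ (−θ) (f y)`. -/
theorem twin_back (h : ∀ y, f (y + a) = rotZ θ (f y)) (y : E3) : f (y - a) = rotZ (-θ) (f y) := by
  have := h (y - a)
  rw [sub_add_cancel] at this
  rw [this, RotationOrder.rotZ_neg_rotZ]

/-- PENCIL READINGS VANISH: for a differentiable divergence-free field with a rotational twin of order ≥ 3
(`sin θ ≠ 0`), `A = ∂₀f₀ + ∂₁f₁`, `B = ∂₀f₁ − ∂₁f₀` and `C = ∂₂f₂` vanish at every point. -/
theorem pen_readings_eq_zero (hf : Differentiable ℝ f) (hdiv : VectorCalculus.IsDivFree f)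
    (hθ : Real.sin θ ≠ 0) (h : ∀ y, f (y + a) = rotZ θ (f y)) (y : E3) :
    penA (fderiv ℝ f y) = 0 ∧ penB (fderiv ℝ f y) = 0 ∧ penC (fderiv ℝ f y) = 0 := by
  have h0 : penA (fderiv ℝ f y) + penC (fderiv ℝ f y) = 0 := by
    rw [← divergence_eq_pen (hf y)]; exact hdiv y
  -- `rotZ θ ∘ f = f (· + a)` and `rotZ (−θ) ∘ f = f (· − a)` are divergence free
  have h1 : VectorCalculus.divergence (fun z => rotZ θ (f z)) y = 0 := by
    have hfun : (fun z => rotZ θ (f z)) = fun z => f (z + a) := funext fun z => (h z).symm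
    rw [hfun]
    unfold VectorCalculus.divergence
    rw [fderiv_comp_add_right]
    exact hdiv (y + a)
  have h2 : VectorCalculus.divergence (fun z => rotZ (-θ) (f z)) y = 0 := by
    have hfun : (fun z => rotZ (-θ) (f z)) = fun z => f (z + (-a)) := funext fun z => by
      rw [← sub_eq_add_neg]; exact (twin_back h z).symm
    rw [hfun]
    unfold VectorCalculus.divergence
    rw [fderiv_comp_add_right]
    exact hdiv (y + -a)
  rw [divergence_rotZ_comp (hf y)] at h1 h2
  rw [Real.cos_neg, Real.sin_neg, neg_mul, sub_neg_eq_add] at h2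
  exact pen_eq_zero hθ h0 h1 h2

/-- The FROZEN FIELD at height `s`: the horizontal part of `f` on the horizontal plane `{y₂ = s}`,
extended vertically: `frozen f s y = hQ (f (hQ y + s e₂))`. -/
def frozen (f : E3 → E3) (s : ℝ) (y : E3) : E3 := hQ (f (hQ y + s • e2))

/-- Derivative computation (`hasFDerivAt_frozen`). -/
theorem hasFDerivAt_frozen (hf : Differentiable ℝ f) (s : ℝ) (y : E3) :
    HasFDerivAt (frozen f s) (hQ.comp ((fderiv ℝ f (hQ y + s • e2)).comp hQ)) y := by
  have h1 : HasFDerivAt (fun y : E3 => hQ y + s • e2) hQ y := hQ.hasFDerivAt.add_const _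
  exact hQ.hasFDerivAt.comp y ((hf _).hasFDerivAt.comp y h1)

/-- Regularity (`contDiff_frozen`). -/
theorem contDiff_frozen {n : WithTop ℕ∞} (hf : ContDiff ℝ n f) (s : ℝ) : ContDiff ℝ n (frozen f s) :=
  hQ.contDiff.comp (hf.comp (hQ.contDiff.add contDiff_const))

/-- Auxiliary lemma of the line, stated and proved verbatim (`hQ_single_zero`). -/
@[simp] theorem hQ_single_zero : hQ (EuclideanSpace.single 0 1) = EuclideanSpace.single 0 1 := by
  ext i; fin_cases i <;> simp [hQ]
/-- Auxiliary lemma of the line, stated and proved verbatim (`hQ_single_one`). -/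
@[simp] theorem hQ_single_one : hQ (EuclideanSpace.single 1 1) = EuclideanSpace.single 1 1 := by
  ext i; fin_cases i <;> simp [hQ]
/-- Auxiliary lemma of the line, stated and proved verbatim (`hQ_single_two`). -/
@[simp] theorem hQ_single_two : hQ (EuclideanSpace.single 2 1) = 0 := by
  ext i; fin_cases i <;> simp [hQ]

/-- The curl of the frozen field is vertical and equals `B` at the frozen point. -/
theorem curl_frozen (hf : Differentiable ℝ f) (s : ℝ) (y : E3) :
    curl (frozen f s) y = WithLp.toLp 2 ![0, 0, penB (fderiv ℝ f (hQ y + s • e2))] := by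
  rw [curl, (hasFDerivAt_frozen hf s y).fderiv]
  simp [penB]

/-- The divergence of the frozen field is `A` at the frozen point. -/
theorem divergence_frozen (hf : Differentiable ℝ f) (s : ℝ) (y : E3) :
    VectorCalculus.divergence (frozen f s) y = penA (fderiv ℝ f (hQ y + s • e2)) := by
  rw [divergence_eq_sum_inner_fderiv (EuclideanSpace.basisFun (Fin 3) ℝ), (hasFDerivAt_frozen hf s y).fderiv]
  simp [Fin.sum_univ_three, EuclideanSpace.inner_single_left, penA]

/-- An elementary bound (`norm_frozen_le`). -/
theorem norm_frozen_le {K : ℝ} (hK : ∀ x, ‖f x‖ ≤ K) (s : ℝ) (y : E3) : ‖frozen f s y‖ ≤ K :=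
  (norm_hQ_le _).trans (hK _)

/-- HORIZONTAL PART DEPENDS ON THE HEIGHT ONLY: with `A = B = 0` everywhere the frozen fields are curl-free,
divergence-free, bounded and `C²`, hence constant (vector Liouville, tree `eq_of_curl_eq_zero_of_isDivFree_of_bounded`). -/
theorem hQ_apply_eq (hf : ContDiff ℝ 2 f) {K : ℝ} (hK : ∀ x, ‖f x‖ ≤ K)
    (hA : ∀ y, penA (fderiv ℝ f y) = 0) (hB : ∀ y, penB (fderiv ℝ f y) = 0) (y : E3) :
    hQ (f y) = hQ (f ((y 2) • e2)) := by
  have hd : Differentiable ℝ f := hf.differentiable (by norm_num)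
  have hcurl : ∀ z, curl (frozen f (y 2)) z = 0 := fun z => by
    rw [curl_frozen hd, hB]
    ext i; fin_cases i <;> simp
  have hdiv : VectorCalculus.IsDivFree (frozen f (y 2)) := fun z => by
    rw [divergence_frozen hd, hA]
  have := eq_of_curl_eq_zero_of_isDivFree_of_bounded (contDiff_frozen hf (y 2)) hcurl hdiv
    (norm_frozen_le hK (y 2)) y 0
  simpa [frozen, hQ_add_smul_e2] using this

/-- THIRD COMPONENT IS VERTICALLY INVARIANT: `C = ∂₂f₂ = 0` everywhere ⇒ `f (y + τ e₂) 2 = f y 2`. -/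
theorem apply_two_add_smul_e2 (hf : Differentiable ℝ f) (hC : ∀ y, penC (fderiv ℝ f y) = 0) (y : E3) (τ : ℝ) :
    f (y + τ • e2) 2 = f y 2 := by
  set g : ℝ → E3 := fun σ => vQ (f (y + σ • e2)) with hg
  have hder : ∀ σ, HasDerivAt g (vQ (fderiv ℝ f (y + σ • e2) e2)) σ := by
    intro σ
    have h1 : HasDerivAt (fun σ : ℝ => y + σ • e2) e2 σ := by
      simpa using ((hasDerivAt_id σ).smul_const e2).const_add y
    have h2 : HasDerivAt (fun σ : ℝ => f (y + σ • e2)) (fderiv ℝ f (y + σ • e2) e2) σ :=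
      (hf _).hasFDerivAt.comp_hasDerivAt σ h1
    exact vQ.hasFDerivAt.comp_hasDerivAt σ h2
  have hdiff : Differentiable ℝ g := fun σ => (hder σ).differentiableAt
  have hzero : ∀ σ, deriv g σ = 0 := fun σ => by
    rw [(hder σ).deriv]
    have := hC (y + σ • e2)
    simp only [penC, e2] at this ⊢
    ext i; fin_cases i
    · simp
    · simp
    · simpa using this
  have := congrArg (fun v : E3 => v 2) (is_const_of_deriv_eq_zero hdiff hzero τ 0)
  simpa [hg] using this

/-- THE KERNEL: a bounded incompressible `C²` field with a rotational Floquet twin of order ≥ 3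
(`f (y + a) = rotZ θ (f y)`, `sin θ ≠ 0`) is PERIODIC with period the horizontal part `hQ a` of the shift. -/
theorem periodic_of_rot_twin (hf : ContDiff ℝ 2 f) (hdiv : VectorCalculus.IsDivFree f) {K : ℝ}
    (hK : ∀ x, ‖f x‖ ≤ K) (hθ : Real.sin θ ≠ 0) (h : ∀ y, f (y + a) = rotZ θ (f y)) (y : E3) :
    f (y + hQ a) = f y := by
  have hd : Differentiable ℝ f := hf.differentiable (by norm_num)
  have hpen := pen_readings_eq_zero hd hdiv hθ h
  have hA : ∀ z, penA (fderiv ℝ f z) = 0 := fun z => (hpen z).1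
  have hB : ∀ z, penB (fderiv ℝ f z) = 0 := fun z => (hpen z).2.1
  have hC : ∀ z, penC (fderiv ℝ f z) = 0 := fun z => (hpen z).2.2
  -- horizontal components: functions of the height only, and `hQ a` does not change the height
  have hh : hQ (f (y + hQ a)) = hQ (f y) := by
    rw [hQ_apply_eq hf hK hA hB (y + hQ a), hQ_apply_eq hf hK hA hB y]
    simp
  -- third component: vertically invariant, so the twin's full shift `a` may replace `hQ a`
  have h3 : f (y + hQ a) 2 = f y 2 := by
    have := apply_two_add_smul_e2 hd hC (y + hQ a) (a 2)
    rw [add_assoc, hQ_add_smul_e2, h, rotZ_apply_two] at this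
    exact this.symm
  ext i
  fin_cases i
  · simpa using congrArg (fun v : E3 => v 0) hh
  · simpa using congrArg (fun v : E3 => v 1) hh
  · exact h3

end Kernel

/-! ### §G  The instrument rows over the class `IsTypeIAncientMild` (rung (L′) cells A2bl·) -/

section Rows

/-- ROW A2blN (DECIDED, FATAL — cheap): a Floquet twin of one slice on one pocket with a FINITE-ORDER
monodromy (`G ^ N = 1`, `N ≥ 1`) and a non-zero shift. -/
def Row_A2blN : Prop :=
  ∀ (C : ℝ) (u : ℝ → E3 → E3), IsTypeIAncientMild C u →
    (∃ (t₀ : ℝ) (G : E3 →L[ℝ] E3) (N : ℕ) (a : E3) (U : Set E3), t₀ < 0 ∧ 0 < N ∧ G ^ N = 1 ∧ a ≠ 0 ∧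
      IsOpen U ∧ U.Nonempty ∧ ∀ x ∈ U, u t₀ (x + a) = G (u t₀ x)) →
    ∀ t < 0, ∀ x, u t x = 0

/-- **Row `Row_A2blN` holds.** -/
theorem row_A2blN : Row_A2blN := by
  rintro C u hu ⟨t₀, G, N, a, U, ht₀, hN0, hGN, ha, hU, hne, h⟩
  have hg := twin_of_pocket (hu.analyticOnNhd_slice_univ ht₀) hU hne h
  exact eq_zero_of_slice_periodic hu ht₀ (p := (N : ℝ) • a)
    (smul_ne_zero (Nat.cast_ne_zero.2 hN0.ne') ha) (periodic_of_twin_finiteOrder hg hGN)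

/-- ROW A2blC (DECIDED, FATAL): a Floquet twin of one slice on one pocket with a CONTRACTING monodromy
(`‖G v‖ ≤ q ‖v‖`, `q < 1`; the shift may even vanish). By time reversal of the reading (`x ↦ x − a`,
`G ↦ G⁻¹`) this also covers expanding invertible monodromies. -/
def Row_A2blC : Prop :=
  ∀ (C : ℝ) (u : ℝ → E3 → E3), IsTypeIAncientMild C u →
    (∃ (t₀ : ℝ) (G : E3 →L[ℝ] E3) (q : ℝ) (a : E3) (U : Set E3), t₀ < 0 ∧ q < 1 ∧ (∀ v, ‖G v‖ ≤ q * ‖v‖) ∧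
      IsOpen U ∧ U.Nonempty ∧ ∀ x ∈ U, u t₀ (x + a) = G (u t₀ x)) →
    ∀ t < 0, ∀ x, u t x = 0

/-- **Row `Row_A2blC` holds.** -/
theorem row_A2blC : Row_A2blC := by
  rintro C u hu ⟨t₀, G, q, a, U, ht₀, hq1, hG, hU, hne, h⟩
  have hg := twin_of_pocket (hu.analyticOnNhd_slice_univ ht₀) hU hne h
  have hq0 : 0 ≤ q := by
    have h1 := hG (EuclideanSpace.single 0 1)
    rw [PiLp.norm_single, norm_one, mul_one] at h1
    exact (norm_nonneg _).trans h1
  exact eq_zero_of_slice_zero hu ht₀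
    (eq_zero_of_twin_contracting hg hq0 hq1 hG (norm_slice_le hu ht₀))

/-- ROW A2blU (DECIDED, FATAL): a Floquet twin of one slice on one pocket with a UNIPOTENT monodromy
`G = 1 + N`, `N² = 0`, `N` arbitrary (possibly `0`: then this is census A13 itself), non-zero shift. -/
def Row_A2blU : Prop :=
  ∀ (C : ℝ) (u : ℝ → E3 → E3), IsTypeIAncientMild C u →
    (∃ (t₀ : ℝ) (N : E3 →L[ℝ] E3) (a : E3) (U : Set E3), t₀ < 0 ∧ N.comp N = 0 ∧ a ≠ 0 ∧
      IsOpen U ∧ U.Nonempty ∧ ∀ x ∈ U, u t₀ (x + a) = u t₀ x + N (u t₀ x)) →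
    ∀ t < 0, ∀ x, u t x = 0

/-- **Row `Row_A2blU` holds.** -/
theorem row_A2blU : Row_A2blU := by
  rintro C u hu ⟨t₀, N, a, U, ht₀, hN, ha, hU, hne, h⟩
  have h' : ∀ x ∈ U, u t₀ (x + a) = (1 + N) (u t₀ x) := fun x hx => by
    rw [h x hx]; rfl
  have hg := twin_of_pocket (hu.analyticOnNhd_slice_univ ht₀) hU hne h'
  have hg' : ∀ x, u t₀ (x + a) = u t₀ x + N (u t₀ x) := fun x => by
    rw [hg x]; rfl
  exact eq_zero_of_slice_periodic hu ht₀ ha (periodic_of_twin_unipotent hN hg' (norm_slice_le hu ht₀))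

/-- ROW A2blR (DECIDED, FATAL — the substantive cell): a Floquet twin of one slice on one pocket whose
monodromy is a ROTATION OF ORDER ≥ 3 UP TO AN ARBITRARY LINEAR CONJUGATION, `G = D ∘ rotZ θ ∘ D⁻¹` with
`sin θ ≠ 0` and `D : ℝ³ ≃L ℝ³` any linear automorphism (so `G` need not be an isometry), and whose shift is
TRANSVERSAL to the rotation axis in the `D`-frame (`D⁻¹ a ∉ ℝ e₂`). -/
def Row_A2blR : Prop :=
  ∀ (C : ℝ) (u : ℝ → E3 → E3), IsTypeIAncientMild C u →
    (∃ (t₀ : ℝ) (D : E3 ≃L[ℝ] E3) (θ : ℝ) (a : E3) (U : Set E3), t₀ < 0 ∧ Real.sin θ ≠ 0 ∧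
      ((D.symm a) 0 ≠ 0 ∨ (D.symm a) 1 ≠ 0) ∧ IsOpen U ∧ U.Nonempty ∧
      ∀ x ∈ U, u t₀ (x + a) = D (rotZ θ (D.symm (u t₀ x)))) →
    ∀ t < 0, ∀ x, u t x = 0

/-- **Row `Row_A2blR` holds.** -/
theorem row_A2blR : Row_A2blR := by
  rintro C u hu ⟨t₀, D, θ, a, U, ht₀, hθ, hT, hU, hne, h⟩
  set G : E3 →L[ℝ] E3 := (D : E3 →L[ℝ] E3).comp ((rotZL θ).comp (D.symm : E3 →L[ℝ] E3)) with hG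
  have h' : ∀ x ∈ U, u t₀ (x + a) = G (u t₀ x) := fun x hx => by
    simp [hG, h x hx, rotZL_apply]
  have hg := twin_of_pocket (hu.analyticOnNhd_slice_univ ht₀) hU hne h'
  -- the conjugated slice `f = D⁻¹ ∘ u t₀ ∘ D`
  set f : E3 → E3 := fun y => D.symm (u t₀ (D y)) with hf
  have hf2 : ContDiff ℝ 2 f :=
    D.symm.contDiff.comp (((hu.analyticOnNhd_slice_univ ht₀).contDiff).comp D.contDiff)
  have hK : ∀ y, ‖f y‖ ≤ ‖(D.symm : E3 →L[ℝ] E3)‖ * (C / Real.sqrt (-t₀)) := fun y =>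
    (D.symm : E3 →L[ℝ] E3).le_opNorm_of_le (norm_slice_le hu ht₀ _)
  have hdivf : VectorCalculus.IsDivFree f := fun y => by
    have hd : Differentiable ℝ (u t₀) := (hu.contDiff_slice ht₀).differentiable (by simp)
    have := divergence_conj D.symm (F := u t₀) (x := y) (hd _)
    simp only [ContinuousLinearEquiv.symm_symm] at this
    rw [hf, this]
    exact hu.isDivFree ht₀ _
  have htw : ∀ y, f (y + D.symm a) = rotZ θ (f y) := fun y => by
    simp [hf, map_add, hg, hG, rotZL_apply]
  have hper := periodic_of_rot_twin hf2 hdivf hK hθ htw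
  -- the period, pushed back to the `u`-frame
  have hp : D (hQ (D.symm a)) ≠ 0 := by
    intro h0
    have h0' : hQ (D.symm a) = 0 := by simpa using congrArg D.symm h0
    have e0 := congrArg (fun v : E3 => v 0) h0'
    have e1 := congrArg (fun v : E3 => v 1) h0'
    simp only [hQ_apply_zero, hQ_apply_one, PiLp.zero_apply] at e0 e1
    rcases hT with hT | hT
    · exact hT e0
    · exact hT e1
  refine eq_zero_of_slice_periodic hu ht₀ hp fun x => ?_
  have := hper (D.symm x)
  simp only [hf, map_add, ContinuousLinearEquiv.apply_symm_apply] at this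
  exact D.symm.injective this

/-- ROW A2blA (OPEN, typed only): the COAXIAL rotational twin — shift along the rotation axis of the
monodromy (`D⁻¹ a ∈ ℝ e₂ ∖ {0}`), `sin θ ≠ 0`.  If `θ / π ∈ ℚ` this is inside `Row_A2blN`; for `θ / 2π`
irrational the cell is KINEMATICALLY REALISABLE (`control_coaxial` below), so only the class can decide it. -/
@[conjecture] def Row_A2blA : Prop :=
  ∀ (C : ℝ) (u : ℝ → E3 → E3), IsTypeIAncientMild C u →
    (∃ (t₀ : ℝ) (D : E3 ≃L[ℝ] E3) (θ : ℝ) (a : E3) (U : Set E3), t₀ < 0 ∧ Real.sin θ ≠ 0 ∧ a ≠ 0 ∧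
      (D.symm a) 0 = 0 ∧ (D.symm a) 1 = 0 ∧ IsOpen U ∧ U.Nonempty ∧
      ∀ x ∈ U, u t₀ (x + a) = D (rotZ θ (D.symm (u t₀ x)))) →
    ∀ t < 0, ∀ x, u t x = 0

/-- The rows follow from (L′) in its class form. -/
theorem rows_of_L' (hL : ∀ (C : ℝ) (u : ℝ → E3 → E3), IsTypeIAncientMild C u → ∀ t < 0, ∀ x, u t x = 0) :
    Row_A2blN ∧ Row_A2blC ∧ Row_A2blU ∧ Row_A2blR ∧ Row_A2blA :=
  ⟨fun C u hu _ => hL C u hu, fun C u hu _ => hL C u hu, fun C u hu _ => hL C u hu,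
    fun C u hu _ => hL C u hu, fun C u hu _ => hL C u hu⟩

/-- BEARS ON rung (L′) ⟨stmt-NavierStokesRegularity-10661⟩ BY NAME: every row of the Bloch meter is a
consequence of `Theses.SymmetryModuliCount.TypeIAncientLiouville` (the meter refines the census; it proves
no rung and no summit). -/
theorem rows_of_rung (hL : Theses.SymmetryModuliCount.TypeIAncientLiouville) :
    Row_A2blN ∧ Row_A2blC ∧ Row_A2blU ∧ Row_A2blR ∧ Row_A2blA :=
  rows_of_L' fun C u hu => hL C u (isTypeIAncientMild_iff.1 hu)

end Rows

end Summit.NavierStokesRegularity.NavierStokesRegularity.Theorems.ScenarioCensus.BlochMeter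

end
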